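import Summits.BirchSwinnertonDyer.BirchSwinnertonDyer.Theorems.ByReductionTypeAtTwoMultLowerHalfSelmerRankSplit
import Literature.NumberTheory.EllipticCurves.Spiess2014.WeakExceptionalZero
import HarnessLib

/-!
# Route `ByReductionTypeAtTwo` / `TwoAdicConverse` (rungs K4ᵐ / S3ᵐ), SPLIT sign: the rank-`0` `2`-CONVERSE
# twins of the Kato-INT pinch doors re-keyed from the named fact `greenberg_stevens W 2` (MEMO at `2`) to the
# PRINTED weak exceptional-zero vanishing `Spiess2014.thm57_weakExceptionalZero_splitMultiplicative_rat W 2`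
# (p456266), with the binder `hlow` discharged by one finite-layer count (mult-3 GEN 6, p445915/p446547)

HONEST FRAMING (cell `bsd-2adic`, run/shared/lean/pub/bsd-2adic/, seat `bsd-2adic-mult-3` GEN 7, HUMAN RULINGS
D-0036 / D-0054 / D-0074 row (A)): research route; THEOREMS ONLY — no definition, no new named fact, nothing
asserted, nothing booked; BSD is not proved by any of this. PARTITION (D-0054): none — RANK axis (S3 mult,
split sign: the rank-`0` `2`-converse `Sel_{2^∞}(E/ℚ)` finite ⇒ `r_an(E) = 0` AT a split ∧ `ρ_{E,2^∞}` surjective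
∧ `Δ < 0` class, items 19219 / 19187 per class through conv-2's twins); companion formula cell X5@2 mult
(K4ᵐ, B1·O1; the split tier-1/2/3 SelmerRank rows of HOME/mult3/sel2layer-k4/) — types-the-object-of; closes
none.

WHAT THIS FILE DOES. Of the split doors of the SelmerRank road, the BSD₂ / upper-half / lower-half forms lost
`hGS` to the `κ₁`-valuation CERTIFICATE (mult GEN 8, p451828; composed with the `hlow` discharge in
`…SelmerRankSplitKappa.lean`, p462280) — but the rank-`0` `2`-CONVERSE forms could not: there
`greenberg_stevens W 2` is genuine content, used (only) as «`[T¹]L ≠ 0 ⇒ [0]⁺_f ≠ 0`»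
(`X5.O1.entireLFunction_one_ne_zero_of_finite_selmer_of_charIdeal_eq_span_split`, last step). That
contrapositive IS the weak exceptional-zero vanishing printed with no parity hypothesis on `p` — Spieß,
Invent. Math. 196 (2014) Thm. 5.7 at `F = ℚ`, `r = 1` (`L_p'(0,π_E) = 𝓛_p(π_E)·L(E,1)`, whatever the
automorphic `𝓛`-invariant is) — typed by seat mult-gs-c as the cite-tagged fact
`Literature.NumberTheory.EllipticCurves.Spiess2014.thm57_weakExceptionalZero_splitMultiplicative_rat W p`
(p456266) and already used to re-key the `MultEisenstein` converse door (`Theorems/TwoAdicConverseMultSplitWeakEZ`,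
p462242). Here the same re-keying is done for the Kato-INT pinch converse doors:
* §1 `entireLFunction_one_ne_zero_of_finite_selmer_of_charIdeal_eq_span_split_of_weakEZ` — the X5 lemma
  verbatim (seat bsd-2adic-mult, `X5/TwoAdicTargetsMultPinchSplit.lean`) with `hW` in place of `hGS` at its
  last step: split main-conjecture equality `char_Λ X = (L₁)`, `ι(T·L₁) = ϖ·L` + A236 + `Sel` finite ⇒
  `L(E,1) ≠ 0 ∧ r_an = 0`.
* §2 `analyticRank_eq_zero_of_finite_selmer_of_katoIntSplitPinch_of_weakEZ` (door 34-INT-pinch-split, converse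
  form, `hlow` displayed) and `analyticRank_eq_zero_of_finite_selmer_of_katoUpToOneSplitPinch_of_mu_of_weakEZ`
  (the `Δ > 0` slack-one face) — the X5 doors (p433154 / p443104) verbatim but for §1.
* §3 the SelmerRank forms with `hlow` DISCHARGED (Greenberg Prop. 4.14 at `2` + one layer count, p445915):
  `analyticRank_eq_zero_of_finite_selmer_of_katoIntSplit_of_layerSelmer_of_weakEZ` /
  `…_of_selmerTwoTorsion_of_weakEZ` / `…katoUpToOneSplitPinch_of_mu_of_layerSelmer_of_weakEZ`.
After this file a split ∧ surjective ∧ `Δ < 0` SelmerRank row displays, for the CONVERSE, PRINT {A236 `h41`,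
`hmod`, Prop. 4.14@2 `h414`, Spieß Thm. 5.7 `hW`} + MEMO {T-KATO2-SPMULT `hKint`} + CERTIFICATES {`hlan`,
`hμan`, `hsel`} — no `hGS`, no `hlow`; every theorem is implied by its `hGS` original
(`Spiess2014.thm57_weakExceptionalZero_splitMultiplicative_rat_of_greenberg_stevens`). The referee desk
(D-audit, claimed by bsd-2adic-audit-1 GEN 8) rules on the PRINT word for the Spieß fact; this file only shows
what it buys.

References: M. Spieß, Invent. Math. 196 (2014), Thm. 5.7, Prop. 4.10, Def. 3.11, Rem. 5.11 (a); R. Greenberg,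
LNM 1716 (1999), §4 pp. 112–113, Prop. 4.14 (p. 124); B. Mazur, J. Tate, J. Teitelbaum, Invent. Math. 84 (1986),
§I.13–15, §II; K. Barré-Sirieix, G. Diaz, F. Gramain, G. Philibert, Invent. Math. 124 (1996), Thm. 1.
-/

set_option autoImplicit false
-- the route's Theorems namespace repeats a component by design (summit = sub-problem, D-0017 nested layout)
set_option linter.dupNamespace false

noncomputable section

open scoped Classical MatrixGroups ModularForm

open CongruenceSubgroup WeierstrassCurve Literature.NumberTheory.EllipticCurves
  Literature.NumberTheory.EllipticCurves.ModularForms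
  Literature.NumberTheory.EllipticCurves.Greenberg1999
  Literature.NumberTheory.EllipticCurves.Rank1Residual
  Literature.NumberTheory.EllipticCurves.Rank1Residual.Typed
  Literature.NumberTheory.EllipticCurves.Spiess2014
  Literature.NumberTheory.Transcendental
  Summit.BirchSwinnertonDyer.Rank1Residual
  Summit.BirchSwinnertonDyer.Rank1Residual.X5 Summit.BirchSwinnertonDyer.Rank1Residual.X5.O1

namespace Summit.BirchSwinnertonDyer.BirchSwinnertonDyer.Theorems.MultSelmerRank

variable (W : WeierstrassCurve ℚ) [W.IsElliptic] [W.IsGloballyMinimal]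

/-! ## §1 The split main-conjecture equality + A236 + Spieß Thm. 5.7 ⇒ `L(E,1) ≠ 0` -/

omit [W.IsGloballyMinimal] in
/-- **The rank-`0` `2`-CONVERSE from the split main-conjecture equality, on the PRINTED weak exceptional zero
(PROVED).** Data: A236 as `hEC` (`TwoAdicEulerCharRankZeroSplitMult W 0`), the Spieß fact `hW`, a cyclotomic
dual datum with `X` torsion, `char_Λ X = (L₁)`, `ι(T·L₁) = ϖ·L` with `L` THE split `2`-adic `L`-function of the
newform `f`. If `Sel_{2^∞}(E/ℚ)` is finite then `L(E,1) ≠ 0` and `r_an(E) = 0`: A236 gives `L₁(0) ≠ 0`, i.e.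
`ϖ·[T¹]L ≠ 0`, and Spieß Thm. 5.7 (contrapositive `[T¹]L ≠ 0 ⇒ [0]⁺_f ≠ 0`) gives `L(E,1) ≠ 0`. Verbatim
`X5.O1.entireLFunction_one_ne_zero_of_finite_selmer_of_charIdeal_eq_span_split` (seat bsd-2adic-mult) with `hW`
REPLACING `hGS` at the last step. [cite: Spiess2014Invent, Thm. 5.7 (F = ℚ, r = 1)]
[cite: GreenbergLNM1716, §4 pp. 112–113 (split l_v)] [cite: MazurTateTeitelbaum1986Invent, §II.10] -/
theorem entireLFunction_one_ne_zero_of_finite_selmer_of_charIdeal_eq_span_split_of_weakEZ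
    (hEC : TwoAdicEulerCharRankZeroSplitMult W 0)
    (hW : thm57_weakExceptionalZero_splitMultiplicative_rat W 2)
    (hmult : Mult W 2) (hsp : W.HasSplitMultiplicativeReductionAtPrime 2)
    {κ : ZpExtension ℚ 2} {γ : Field.absoluteGaloisGroup ℚ} {N : ℕ} [NeZero N]
    {f : CuspForm (Gamma0 N) 2} (hκ : κ.IsCyclotomic) (hγ : κ.IsTopGenerator γ)
    (hγ' : IsCyclotomicVariable 2 γ) (hf : IsNewformOf W f) {L : PowerSeries ℚ_[2]}
    (hLf : IsSplitMultPAdicLFunctionOf f 2 L) (D : W.SelmerDualData κ γ) (hX : D.IsTorsion)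
    {ϖ : ℚ} {L₁ : IwasawaAlgebra 2}
    (hιL₁ : iwasawaToPowerSeries 2 (PowerSeries.X * L₁) = PowerSeries.C (ϖ : ℚ_[2]) * L)
    (hchar : D.charIdeal = Ideal.span {L₁}) (hfin : Finite (W.selmerGroupPInfty 2)) :
    W.entireLFunction 1 ≠ 0 ∧ W.analyticRank = 0 := by
  haveI : Module.Finite (IwasawaAlgebra 2) D.X := D.module_finite_holds hγ
  haveI := hfin
  obtain ⟨hEfin, hShapfin⟩ := (W.finite_selmerGroupPInfty_iff 2).mp hfin
  haveI := hEfin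
  haveI := hShapfin
  obtain ⟨Dq⟩ := (nonempty_tateParameterData_iff_holds (W := W) (p := 2)).mpr hsp
  have hlog : padicLog 2 Dq.q ≠ 0 := Dq.padicLog_q_ne_zero MahlerManinPadic_holds
  obtain ⟨u₁, hu₁⟩ := hEC hmult hsp κ γ hκ hγ hγ' D hX L₁ hchar hfin Dq hlog
  have hR : ((u₁ : ℤ_[2]) : ℚ_[2]) * (LInvariant Dq / 4) *
      (2 : ℚ_[2]) ^ ((padicValNat 2 W.tamagawaProduct : ℤ) + 0) *
      (Nat.card (W.selmerGroupPInfty 2) : ℚ_[2]) ≠ 0 := by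
    refine mul_ne_zero (mul_ne_zero (mul_ne_zero (coe_units_ne_zero 2 u₁)
      (div_ne_zero (LInvariant_ne_zero_holds (W := W) (p := 2) Dq) (by norm_num)))
      (zpow_ne_zero _ two_ne_zero)) ?_
    exact_mod_cast Nat.card_pos.ne'
  rw [← hu₁] at hR
  have hL₁0 : ((PowerSeries.constantCoeff L₁ : ℤ_[2]) : ℚ_[2]) ≠ 0 :=
    fun h0 => hR (by rw [h0, zero_mul])
  have hc : ((PowerSeries.constantCoeff L₁ : ℤ_[2]) : ℚ_[2]) = (ϖ : ℚ_[2]) * PowerSeries.coeff 1 L := by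
    have h1 := congrArg (PowerSeries.coeff 1) hιL₁
    rw [coeff_one_iwasawaToPowerSeries_X_mul, PowerSeries.coeff_C_mul] at h1
    exact h1
  have hc₁0 : PowerSeries.coeff 1 L ≠ 0 := by
    intro h0
    apply hL₁0
    rw [hc, h0, mul_zero]
  -- Spieß Thm. 5.7 at `(W, 2)`, contrapositive: `[T¹]L ≠ 0 ⇒ [0]⁺_f ≠ 0`
  have hs0 : ratPlusSymbol f 0 ≠ 0 := hW.ratPlusSymbol_zero_ne_zero Dq hf hLf hc₁0
  have hL : W.entireLFunction 1 ≠ 0 := by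
    rw [hf.entireLFunction_one_eq]
    have hper : 0 < plusPeriod f := IsNewform0.plusPeriod_pos_holds hf.1 hf.coeffField_eq_bot
    exact_mod_cast mul_ne_zero (Rat.cast_ne_zero.mpr hs0) hper.ne'
  exact ⟨hL, analyticRank_eq_zero_of_entireLFunction_one_ne_zero W hL⟩

/-! ## §2 The X5 converse doors (34-INT-pinch-split / -split⁺) on the Spieß fact, `hlow` displayed -/

/-- **DOOR (34-INT-pinch-split), CONVERSE FORM, on the PRINTED weak exceptional zero** (split `E`, `E[2]`
irreducible, `Δ < 0`): PRINT {A236 `h41`, `hmod`, Spieß Thm. 5.7 `hW`} + MEMO {T-KATO2-SPMULT `hKint`, the Selmer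
bound `hlow`} + CERTIFICATES {`hlan`, `hμan`}; `Sel_{2^∞}(E/ℚ)` finite ⇒ `L(E,1) ≠ 0 ∧ r_an(E) = 0`. Verbatim
`X5.O1.analyticRank_eq_zero_of_finite_selmer_of_katoIntSplitPinch` (p433154) with §1 as its last step.
[cite: Spiess2014Invent, Thm. 5.7] [cite: GreenbergLNM1716, §4 pp. 112–113 and Prop. 4.14 (p. 124)]
[cite: MazurTateTeitelbaum1986Invent, §I.13–15 and §II] -/
theorem analyticRank_eq_zero_of_finite_selmer_of_katoIntSplitPinch_of_weakEZ {n : ℕ}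
    (h41 : thm41Analogue_charValue_rankZero_split_baseChange_anyPrime)
    (hW : thm57_weakExceptionalZero_splitMultiplicative_rat W 2)
    (hmod : nonempty_modularParametrizationData)
    (hKint : KatoDivisibilityAtTwoSplitMultInt W) (hlow : SelmerLambdaLowerBoundAtTwo W n)
    (hmult : Mult W 2) (hsp : W.HasSplitMultiplicativeReductionAtPrime 2)
    (him : TwoAdicSurjective W) (hΔ : W.Δ < 0)
    (hlan : X2.AnalyticLambdaEq W 2 (n + 1)) (hμan : X2.AnalyticMuLE W 2 0)
    (hfin : Finite (W.selmerGroupPInfty 2)) : W.entireLFunction 1 ≠ 0 ∧ W.analyticRank = 0 := by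
  haveI : NeZero (W.conductorNorm ℤ) := ⟨(W.conductorNorm_pos_holds).ne'⟩
  obtain ⟨Dm⟩ := hmod W
  have hf : IsNewformOf W Dm.f := Dm.isNewformOf
  obtain ⟨ϖ, -, hϖ, -⟩ := Dm.exists_rat_mul_realPeriodRat_eq_plusPeriod
  obtain ⟨κ, hκ, γ, hγ, hγ'⟩ := exists_isCyclotomic_isTopGenerator_isCyclotomicVariable_holds 2
  obtain ⟨DW⟩ := W.nonempty_selmerDualData_holds κ γ hγ
  obtain ⟨L, hLf⟩ := exists_isSplitMultPAdicLFunctionOf hsp hf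
  obtain ⟨hX, g, hg, hι⟩ := hKint hmult hsp him hΔ Dm.f hf L hLf κ γ hκ hγ hγ' DW ϖ hϖ
  have hchar := charIdeal_eq_span_of_katoIntSplit_selmerPinch W hsp hlan hμan hκ hγ hγ' hf hLf DW hX
    hϖ hι hg hlow
  exact entireLFunction_one_ne_zero_of_finite_selmer_of_charIdeal_eq_span_split_of_weakEZ W
    (twoAdicEulerCharRankZeroSplitMult_zero_of_greenberg W h41) hW hmult hsp hκ hγ hγ' hf hLf DW hX
    hι hchar hfin

/-- **DOOR (34-INT-pinch-split⁺), CONVERSE FORM, on the PRINTED weak exceptional zero** (split `E`, `Δ > 0`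
allowed; the slack-one datum `hK1sp`, `μ(X) = 0` displayed as `hμX`, `hlow`, `hper₀`): PRINT {A236 `h41`, `hmod`,
Spieß Thm. 5.7 `hW`}; `Sel_{2^∞}(E/ℚ)` finite ⇒ `L(E,1) ≠ 0 ∧ r_an(E) = 0`. Verbatim
`X5.O1.analyticRank_eq_zero_of_finite_selmer_of_katoUpToOneSplitPinch_of_mu` (p443104) with §1 as its last step.
[cite: Spiess2014Invent, Thm. 5.7] [cite: GreenbergLNM1716, §4 pp. 112–113, Conj. 1.11 and Prop. 4.14 (p. 124)]
[cite: MazurTateTeitelbaum1986Invent, §I.10, §I.13–15 and §II] -/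
theorem analyticRank_eq_zero_of_finite_selmer_of_katoUpToOneSplitPinch_of_mu_of_weakEZ {n : ℕ}
    (h41 : thm41Analogue_charValue_rankZero_split_baseChange_anyPrime)
    (hW : thm57_weakExceptionalZero_splitMultiplicative_rat W 2)
    (hmod : nonempty_modularParametrizationData)
    (hK1sp : ∀ (κ : ZpExtension ℚ 2) (γ : Field.absoluteGaloisGroup ℚ), κ.IsCyclotomic →
      κ.IsTopGenerator γ → IsCyclotomicVariable 2 γ →
      ∀ [NeZero (W.conductorNorm ℤ)] (f : CuspForm (Gamma0 (W.conductorNorm ℤ)) 2), IsNewformOf W f →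
      ∀ ϖ : ℚ, (ϖ : ℝ) * W.realPeriodRat = plusPeriod f →
      ∀ L : PowerSeries ℚ_[2], IsSplitMultPAdicLFunctionOf f 2 L → ∀ D : W.SelmerDualData κ γ,
        D.IsTorsion ∧ ∃ g ∈ D.charIdeal,
          iwasawaToPowerSeries 2 (PowerSeries.X * g) = PowerSeries.C ((2 * ϖ : ℚ) : ℚ_[2]) * L)
    (hμX : ∀ (κ : ZpExtension ℚ 2) (γ : Field.absoluteGaloisGroup ℚ), κ.IsCyclotomic →
      κ.IsTopGenerator γ → IsCyclotomicVariable 2 γ → ∀ D : W.SelmerDualData κ γ, D.IsTorsion → D.mu = 0)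
    (hlow : SelmerLambdaLowerBoundAtTwo W n)
    (hper₀ : ∀ [NeZero (W.conductorNorm ℤ)] (f : CuspForm (Gamma0 (W.conductorNorm ℤ)) 2),
      IsNewformOf W f → ∀ ϖ : ℚ, (ϖ : ℝ) * W.realPeriodRat = plusPeriod f → 0 ≤ padicValRat 2 ϖ)
    (hmult : Mult W 2) (hsp : W.HasSplitMultiplicativeReductionAtPrime 2)
    (hlan : X2.AnalyticLambdaEq W 2 (n + 1)) (hμan : X2.AnalyticMuLE W 2 0)
    (hfin : Finite (W.selmerGroupPInfty 2)) : W.entireLFunction 1 ≠ 0 ∧ W.analyticRank = 0 := by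
  haveI : NeZero (W.conductorNorm ℤ) := ⟨(W.conductorNorm_pos_holds).ne'⟩
  obtain ⟨Dm⟩ := hmod W
  have hf : IsNewformOf W Dm.f := Dm.isNewformOf
  obtain ⟨ϖ, -, hϖ, -⟩ := Dm.exists_rat_mul_realPeriodRat_eq_plusPeriod
  obtain ⟨κ, hκ, γ, hγ, hγ'⟩ := exists_isCyclotomic_isTopGenerator_isCyclotomicVariable_holds 2
  obtain ⟨DW⟩ := W.nonempty_selmerDualData_holds κ γ hγ
  obtain ⟨L, hLf⟩ := exists_isSplitMultPAdicLFunctionOf hsp hf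
  obtain ⟨hX, g, hg, hι⟩ := hK1sp κ γ hκ hγ hγ' Dm.f hf ϖ hϖ L hLf DW
  obtain ⟨L₀, hL₀⟩ := exists_iwasawaToPowerSeries_eq_of_isSplitMultPAdicLFunctionOf_two hsp hf hLf
  have hϖnorm : ‖((ϖ : ℚ) : ℚ_[2])‖ ≤ 1 := by
    have h := hper₀ Dm.f hf ϖ hϖ
    by_cases h0 : ϖ = 0
    · subst h0; simp
    have hϖQ : ((ϖ : ℚ) : ℚ_[2]) ≠ 0 := by exact_mod_cast h0
    rw [Padic.norm_eq_zpow_neg_valuation hϖQ, Padic.valuation_ratCast]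
    exact zpow_le_one_of_nonpos₀ (by norm_num) (by linarith)
  let ϖ₀ : ℤ_[2] := ⟨((ϖ : ℚ) : ℚ_[2]), hϖnorm⟩
  have hG₀ : iwasawaToPowerSeries 2 ((PowerSeries.C ϖ₀ : IwasawaAlgebra 2) * L₀) =
      PowerSeries.C (ϖ : ℚ_[2]) * L := by
    rw [map_mul, hL₀, iwasawaToPowerSeries, PowerSeries.map_C]
    rfl
  obtain ⟨g₀, hι₀, hchar⟩ := charIdeal_eq_span_of_katoUpToOneSplit_selmerPinch_of_mu W hsp hlan hμan
    hκ hγ hγ' hf hLf DW hX (hμX κ γ hκ hγ hγ' DW hX) hϖ hι hg hG₀ hlow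
  exact entireLFunction_one_ne_zero_of_finite_selmer_of_charIdeal_eq_span_split_of_weakEZ W
    (twoAdicEulerCharRankZeroSplitMult_zero_of_greenberg W h41) hW hmult hsp hκ hγ hγ' hf hLf DW hX
    hι₀ hchar hfin

/-! ## §3 The SelmerRank converse rows: `hlow` discharged AND `hGS` replaced by the Spieß fact -/

/-- **DOOR (34-INT-pinch-split), CONVERSE FORM, `hlow` DISCHARGED, on the PRINTED weak exceptional zero.**
PRINT {A236 `h41`, `hmod`, Prop. 4.14@2 `h414`, Spieß Thm. 5.7 `hW`} + MEMO {T-KATO2-SPMULT `hKint`} ONLY +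
CERTIFICATES {`λ_an(E) = n + 1` (`hlan`), `μ_an(E) = 0` (`hμan`), the layer count `2^n ≤ #Sel_{2^∞}(E/ℚ_j)[2]`
(`hsel`)}; decidable data {`Mult W 2`, split, `TwoAdicSurjective W`, `Δ < 0`}; `Sel_{2^∞}(E/ℚ)` finite ⇒
`L(E,1) ≠ 0 ∧ r_an(E) = 0`. One application of §2 to
`selmerLambdaLowerBoundAtTwo_of_layerSelmer_of_twoAdicSurjective` (p445915). No `hGS`, no `hlow`.
[cite: Spiess2014Invent, Thm. 5.7] [cite: GreenbergLNM1716, §4 pp. 112–113 and Prop. 4.14 (p. 124)]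
[cite: MazurTateTeitelbaum1986Invent, §I.13–15 and §II] -/
theorem analyticRank_eq_zero_of_finite_selmer_of_katoIntSplit_of_layerSelmer_of_weakEZ {j n : ℕ}
    (h41 : thm41Analogue_charValue_rankZero_split_baseChange_anyPrime)
    (hW : thm57_weakExceptionalZero_splitMultiplicative_rat W 2)
    (hmod : nonempty_modularParametrizationData)
    (h414 : prop414_noFiniteSubmodule_of_not_dvd_torsionOrder)
    (hKint : KatoDivisibilityAtTwoSplitMultInt W)
    (hmult : Mult W 2) (hsp : W.HasSplitMultiplicativeReductionAtPrime 2)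
    (him : TwoAdicSurjective W) (hΔ : W.Δ < 0)
    (hlan : X2.AnalyticLambdaEq W 2 (n + 1)) (hμan : X2.AnalyticMuLE W 2 0)
    (hsel : ∀ κ : ZpExtension ℚ 2, κ.IsCyclotomic →
      2 ^ n ≤ Nat.card {z : W.selmerLayer κ j // 2 • z = 0})
    (hfin : Finite (W.selmerGroupPInfty 2)) : W.entireLFunction 1 ≠ 0 ∧ W.analyticRank = 0 :=
  analyticRank_eq_zero_of_finite_selmer_of_katoIntSplitPinch_of_weakEZ W h41 hW hmod hKint
    (selmerLambdaLowerBoundAtTwo_of_layerSelmer_of_twoAdicSurjective W h414 him hsel)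
    hmult hsp him hΔ hlan hμan hfin

/-- **The same from the layer-`0` count `2^n ≤ #Sel_{2^∞}(E/ℚ)[2]`** (TIER-1-SPLIT habitat: `n = 2 =
dim_{𝔽₂} Sel₂(E/ℚ)`, `λ_an = 3`). [cite: Spiess2014Invent, Thm. 5.7]
[cite: GreenbergLNM1716, §4 pp. 112–113 and Prop. 4.14 (p. 124)] [cite: MazurTateTeitelbaum1986Invent, §I.13–15] -/
theorem analyticRank_eq_zero_of_finite_selmer_of_katoIntSplit_of_selmerTwoTorsion_of_weakEZ {n : ℕ}
    (h41 : thm41Analogue_charValue_rankZero_split_baseChange_anyPrime)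
    (hW : thm57_weakExceptionalZero_splitMultiplicative_rat W 2)
    (hmod : nonempty_modularParametrizationData)
    (h414 : prop414_noFiniteSubmodule_of_not_dvd_torsionOrder)
    (hKint : KatoDivisibilityAtTwoSplitMultInt W)
    (hmult : Mult W 2) (hsp : W.HasSplitMultiplicativeReductionAtPrime 2)
    (him : TwoAdicSurjective W) (hΔ : W.Δ < 0)
    (hlan : X2.AnalyticLambdaEq W 2 (n + 1)) (hμan : X2.AnalyticMuLE W 2 0)
    (hsel : 2 ^ n ≤ Nat.card {z : W.selmerGroupPInfty 2 // 2 • z = 0})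
    (hfin : Finite (W.selmerGroupPInfty 2)) : W.entireLFunction 1 ≠ 0 ∧ W.analyticRank = 0 :=
  analyticRank_eq_zero_of_finite_selmer_of_katoIntSplitPinch_of_weakEZ W h41 hW hmod hKint
    (selmerLambdaLowerBoundAtTwo_of_selmerTwoTorsion W h414
      (not_two_dvd_torsionOrder_of_twoAdicSurjective W him) hsel)
    hmult hsp him hΔ hlan hμan hfin

/-- **DOOR (34-INT-pinch-split⁺), CONVERSE FORM, `hlow` DISCHARGED, on the PRINTED weak exceptional zero**
(`Δ > 0` face; slack-one `hK1sp`, displayed `hμX`, `hper₀`, torsion side condition `htors`): `Sel_{2^∞}(E/ℚ)`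
finite ⇒ `L(E,1) ≠ 0 ∧ r_an(E) = 0`. One application of §2 to `selmerLambdaLowerBoundAtTwo_of_layerSelmer`
(p445915). No `hGS`, no `hlow`. [cite: Spiess2014Invent, Thm. 5.7]
[cite: GreenbergLNM1716, §4 pp. 112–113, Conj. 1.11 and Prop. 4.14 (p. 124)] [cite: MazurTateTeitelbaum1986Invent, §I.13–15 and §II] -/
theorem analyticRank_eq_zero_of_finite_selmer_of_katoUpToOneSplitPinch_of_mu_of_layerSelmer_of_weakEZ
    {j n : ℕ}
    (h41 : thm41Analogue_charValue_rankZero_split_baseChange_anyPrime)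
    (hW : thm57_weakExceptionalZero_splitMultiplicative_rat W 2)
    (hmod : nonempty_modularParametrizationData)
    (h414 : prop414_noFiniteSubmodule_of_not_dvd_torsionOrder)
    (hK1sp : ∀ (κ : ZpExtension ℚ 2) (γ : Field.absoluteGaloisGroup ℚ), κ.IsCyclotomic →
      κ.IsTopGenerator γ → IsCyclotomicVariable 2 γ →
      ∀ [NeZero (W.conductorNorm ℤ)] (f : CuspForm (Gamma0 (W.conductorNorm ℤ)) 2), IsNewformOf W f →
      ∀ ϖ : ℚ, (ϖ : ℝ) * W.realPeriodRat = plusPeriod f →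
      ∀ L : PowerSeries ℚ_[2], IsSplitMultPAdicLFunctionOf f 2 L → ∀ D : W.SelmerDualData κ γ,
        D.IsTorsion ∧ ∃ g ∈ D.charIdeal,
          iwasawaToPowerSeries 2 (PowerSeries.X * g) = PowerSeries.C ((2 * ϖ : ℚ) : ℚ_[2]) * L)
    (hμX : ∀ (κ : ZpExtension ℚ 2) (γ : Field.absoluteGaloisGroup ℚ), κ.IsCyclotomic →
      κ.IsTopGenerator γ → IsCyclotomicVariable 2 γ → ∀ D : W.SelmerDualData κ γ, D.IsTorsion → D.mu = 0)
    (hper₀ : ∀ [NeZero (W.conductorNorm ℤ)] (f : CuspForm (Gamma0 (W.conductorNorm ℤ)) 2),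
      IsNewformOf W f → ∀ ϖ : ℚ, (ϖ : ℝ) * W.realPeriodRat = plusPeriod f → 0 ≤ padicValRat 2 ϖ)
    (htors : ¬ 2 ∣ W.torsionOrder)
    (hmult : Mult W 2) (hsp : W.HasSplitMultiplicativeReductionAtPrime 2)
    (hlan : X2.AnalyticLambdaEq W 2 (n + 1)) (hμan : X2.AnalyticMuLE W 2 0)
    (hsel : ∀ κ : ZpExtension ℚ 2, κ.IsCyclotomic →
      2 ^ n ≤ Nat.card {z : W.selmerLayer κ j // 2 • z = 0})
    (hfin : Finite (W.selmerGroupPInfty 2)) : W.entireLFunction 1 ≠ 0 ∧ W.analyticRank = 0 :=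
  analyticRank_eq_zero_of_finite_selmer_of_katoUpToOneSplitPinch_of_mu_of_weakEZ W h41 hW hmod hK1sp hμX
    (selmerLambdaLowerBoundAtTwo_of_layerSelmer W h414 htors hsel) hper₀ hmult hsp hlan hμan hfin

end Summit.BirchSwinnertonDyer.BirchSwinnertonDyer.Theorems.MultSelmerRank

end
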